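import Summits.CriticalPhenomena.SAWScalingLimit.Theorems.SAWTotalPositivityTPToTraversalBoundTopHeavinessTail
import Summits.CriticalPhenomena.SAWScalingLimit.Theorems.SAWTotalPositivityTPToTraversalBoundShellTight
import Summits.CriticalPhenomena.SAWScalingLimit.Theorems.SAWLeftRightFKGSAWTraversalBound

/-!
# Rev 4 ⇒ rev 5 of the line `radial-portal-transfer` (crux `TPToTraversalBound`, stmt-CriticalPhenomena-10687)

The lead-0 skeleton (rev 4, `Cruxes/TPToTraversalBound/Lines/radial_portal_transfer.lean`) closed the crux modulo
FOUR registered stubs: the clean and the decorated heaviness contraction (`CleanContractionCore`,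
`HeavinessContractionCore` — the radial chain's G2 core), the top state in Aizenman–Burchard currency
(`DeepTraversalTail 20 100`) and per-shell tightness on frontier-centred shells (`BoundaryShellTight`). This file
proves that the first two are REDUNDANT and that the remaining pair already implies the single rev-5 stub
`ShellTight` (`…TPToTraversalBoundShellTight`), so rev 5 (one stub, `BoundaryTP2 → CriticalBubbleBound → ShellTight`)
is a WEAKENING of rev 4's stub burden with the same conclusion:

* `interiorShellBound_of_deepTraversalTail : DeepTraversalTail 20 100 → InteriorShellBound` — (H1) on interior
  shells (`closedBall x R ⊆ D`) with EVERY exponent follows from the deep-shell tail ALONE, without the radial chain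
  (`stub_chain`) and without any contraction: a traversal of an interior shell `D(x; ρ, R)` with `R > 100ρ` is a
  traversal of its deep sub-shell `D(x; R/100, R/5)` (`closedBall x (100 · R/100) ⊆ D`), whose traversal number has
  the tail `C e^{-c₁ k}`; the threshold `⌈λ log(R/ρ)/c₁⌉` turns it into `C (ρ/R)^λ`, and ratios `R ≤ 100ρ` are
  absorbed by `K ≥ 100^λ`;
* `traversalBound_of_shellBounds : InteriorShellBound → BoundaryShellBound → SAWTraversalBound` — the rev-4
  skeleton's proved shell reduction (lead 0; re-centring at the nearest point of `Dᶜ`, exponent `6` in, `λ = 3`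
  out), landed here verbatim so that the comparison is a tree theorem;
* `shellTight_of_deepTraversalTail_of_boundaryShellTight : DeepTraversalTail 20 100 → BoundaryShellTight →
  ShellTight` — rev 4's stubs 3′ + 5′ give rev 5's stub (through (H1) and `shellTight_of_traversalBound`), and
  `tpToTraversalBound_of_deepTraversalTail_of_boundaryShellTight` — they already give the crux, contraction-free;
* `shellTight_iff_eventualTight : ShellTight ↔ EventualTight` — the residual is the route's shared precompactness item
  (stmt-CriticalPhenomena-1881) itself: with the PROVED glue `TraversalBoundTight_holds` and the sibling route's
  `sawTraversalBound_of_eventualTight` (Theorems/SAWLeftRightFKGSAWTraversalBound; the two routes' items are the same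
  propositions), `ShellTight ↔ SAWTraversalBound ↔ EventualTight` (`↔ ShellCountTight` of route SAWRenewalTightness,
  `shellCountTight_iff_eventualTight`).

References: M. Aizenman, A. Burchard, Duke Math. J. 99 (1999) §1.b; A. Kemppainen, S. Smirnov, Ann. Probab. 45
(2017) §2–3.
-/

noncomputable section

open MeasureTheory Filter Topology Set Metric
open scoped NNReal ENNReal
open Literature.Probability.LatticeModels
open Literature.Probability.RandomPlanarGeometry
open Literature.Probability.RandomPlanarGeometry.SAW
open Summit.CriticalPhenomena.SAWScalingLimit.Theses.SAWTotalPositivity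
open Summit.CriticalPhenomena.SAWScalingLimit.Theorems.TPToTraversalBound.Negative (law_apply_le_one
  law_hasTraversals_anti)

namespace Summit.CriticalPhenomena.SAWScalingLimit.Theorems.TPToTraversalBound.Radial

/-! ## The contraction stubs are redundant: interior shells from the deep-shell tail alone -/

/-- An exponential tail at threshold `⌈λ log(R/ρ) / c₁⌉` is a power law: `e^{-c₁ k} ≤ (ρ/R)^λ`. -/
theorem exp_neg_mul_ceil_le_rpow {c₁ lam ρ R : ℝ} (hc₁ : 0 < c₁) (hρ : 0 < ρ) (hR : 0 < R) :
    Real.exp (-(c₁ * (⌈lam * Real.log (R / ρ) / c₁⌉₊ : ℕ))) ≤ (ρ / R) ^ lam := by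
  set n : ℕ := ⌈lam * Real.log (R / ρ) / c₁⌉₊ with hn
  have hk : lam * Real.log (R / ρ) / c₁ ≤ (n : ℝ) := Nat.le_ceil _
  have hk' : lam * Real.log (R / ρ) ≤ c₁ * n := by
    rw [div_le_iff₀ hc₁] at hk; linarith
  have hlog : Real.log (R / ρ) = Real.log R - Real.log ρ := Real.log_div hR.ne' hρ.ne'
  rw [Real.rpow_def_of_pos (div_pos hρ hR), Real.log_div hρ.ne' hR.ne']
  refine Real.exp_le_exp.2 ?_
  rw [hlog] at hk'
  nlinarith

/-- **(H1) on interior shells from the deep-shell traversal tail alone** (no radial chain, no contraction):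
`DeepTraversalTail 20 100 → InteriorShellBound`. For an interior shell `D(x; ρ, R)` (`closedBall x R ⊆ D`) with
`R > 100ρ`, `k` separate traversals are `k` separate traversals of the deep sub-shell `D(x; R/100, R/5)`, of
probability `≤ C e^{-c₁ k}`; the threshold `⌈λ log(R/ρ)/c₁⌉` makes this `≤ C⁺ (ρ/R)^λ`; for `R ≤ 100ρ` the bound
`K (ρ/R)^λ ≥ 1` is free with `K ≥ 100^λ`. -/
theorem interiorShellBound_of_deepTraversalTail (h : DeepTraversalTail 20 100) : InteriorShellBound := by
  intro lam hlam D a b hab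
  obtain ⟨C, c₁, δ₀, hc₁, hδ₀, hb⟩ := h D a b hab
  refine ⟨fun _ ρ R => ⌈lam * Real.log (R / ρ) / c₁⌉₊, max C 0 + (100 : ℝ) ^ lam, δ₀,
    by positivity, hδ₀, ?_⟩
  intro δ hδ x ρ R hδρ hρR hR1 hball
  have hρ : 0 < ρ := hδ.1.trans_le hδρ
  have hR : 0 < R := hρ.trans hρR
  by_cases hthick : R ≤ 100 * ρ
  · exact law_le_bound_of_le_mul (C := 100) (by norm_num) hlam.le hρ hR hthick
      (le_add_of_nonneg_left (le_max_right _ _)) _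
  rw [not_le] at hthick
  -- the deep sub-shell `D(x; R/100, R/5)`
  have hsub : law D.carrier δ (a δ) (b δ)
      {γ | (⟨γ.walk.toCurve (meshPoint δ)⟩ : Curve ℂ).HasTraversals
        (⌈lam * Real.log (R / ρ) / c₁⌉₊) x ρ R} ≤
      law D.carrier δ (a δ) (b δ)
      {γ | (⟨γ.walk.toCurve (meshPoint δ)⟩ : Curve ℂ).HasTraversals
        (⌈lam * Real.log (R / ρ) / c₁⌉₊) x (R / 100) (20 * (R / 100))} :=
    measure_mono fun γ hγ => Curve.HasTraversals.mono' hγ (by linarith) (by linarith)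
  have hdeep : Metric.closedBall x (100 * (R / 100)) ⊆ D.carrier := by
    rw [show 100 * (R / 100) = R by ring]; exact hball
  have htail := hb δ hδ x (R / 100) (⌈lam * Real.log (R / ρ) / c₁⌉₊) (by linarith) hdeep
  refine hsub.trans (htail.trans (ENNReal.ofReal_le_ofReal ?_))
  have hpow := exp_neg_mul_ceil_le_rpow (lam := lam) hc₁ hρ hR
  have hexp0 : 0 ≤ Real.exp (-(c₁ * (⌈lam * Real.log (R / ρ) / c₁⌉₊ : ℕ))) := (Real.exp_pos _).le
  have hq0 : 0 ≤ (ρ / R) ^ lam := Real.rpow_nonneg (div_pos hρ hR).le _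
  calc C * Real.exp (-(c₁ * (⌈lam * Real.log (R / ρ) / c₁⌉₊ : ℕ)))
      ≤ max C 0 * Real.exp (-(c₁ * (⌈lam * Real.log (R / ρ) / c₁⌉₊ : ℕ))) :=
        mul_le_mul_of_nonneg_right (le_max_left _ _) hexp0
    _ ≤ max C 0 * (ρ / R) ^ lam := mul_le_mul_of_nonneg_left hpow (le_max_right _ _)
    _ ≤ (max C 0 + 100 ^ lam) * (ρ / R) ^ lam := by
        refine mul_le_mul_of_nonneg_right ?_ hq0
        exact le_add_of_nonneg_right (Real.rpow_nonneg (by norm_num) _)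

/-! ## The rev-4 shell reduction (lead 0), landed -/

/-- Real powers with exponent `6` are the monomials. -/
theorem rpow_six (t : ℝ) : t ^ (6 : ℝ) = t ^ (6 : ℕ) := by
  rw [← Real.rpow_natCast]; norm_num

/-- Real powers with exponent `3` are the monomials. -/
theorem rpow_three (t : ℝ) : t ^ (3 : ℝ) = t ^ (3 : ℕ) := by
  rw [← Real.rpow_natCast]; norm_num

/-- **Shell reduction (rev-4 skeleton, lead 0).** (H1) follows from the interior-shell and the
exterior-centred-shell bounds: for a shell `D(x; ρ, R)` with `R ≥ 16ρ` let `d = dist(x, Dᶜ)` and `y ∈ Dᶜ` a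
nearest point. If `d² ≥ ρR` the shell `D(x; ρ, min(d/2, R))` is interior and `(2ρ/d)^6 ≤ (4ρ/R)^3`; if `d² < ρR`
the `k` traversals are traversals of `D(y; ρ + d, R - d)` and `((ρ+d)/(R-d))^6 ≤ (4ρ/R)^3`; if `R < 16ρ` the bound
`4096 (ρ/R)^3 ≥ 1` is free. Exponent `6` in, `λ = 3 > 2` out. -/
theorem traversalBound_of_shellBounds (hI : InteriorShellBound) (hB : BoundaryShellBound) :
    SAWTraversalBound := by
  intro D a b hab
  obtain ⟨kI, KI, δI, hKI, hδI, HI⟩ := hI 6 (by norm_num) D a b hab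
  obtain ⟨kB, KB, δB, hKB, hδB, HB⟩ := hB 6 (by norm_num) D a b hab
  -- a nearest point of the complement of the domain
  have hne : (D.carrierᶜ).Nonempty := Set.nonempty_compl.2 D.toJordanDomain.carrier_ne_univ
  have hcl : IsClosed (D.carrierᶜ) := D.isOpen.isClosed_compl
  choose y hy hdy using fun x : ℂ => hcl.exists_infDist_eq_dist hne x
  set d : ℂ → ℝ := fun x => Metric.infDist x D.carrierᶜ with hd
  refine ⟨fun x ρ R => max (kI x ρ (min (d x / 2) R)) (kB (y x) (ρ + d x) (R - d x)),
    64 * KI + 64 * KB + 4096, 3, min δI δB, by positivity, by norm_num, lt_min hδI hδB, ?_⟩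
  intro δ hδ x ρ R hδρ hρR hR1
  have hδ0 : 0 < δ := hδ.1
  have hρ0 : 0 < ρ := hδ0.trans_le hδρ
  have hR0 : 0 < R := hρ0.trans hρR
  have hδI' : δ ∈ Set.Ioc (0 : ℝ) δI := ⟨hδ0, hδ.2.trans (min_le_left _ _)⟩
  have hδB' : δ ∈ Set.Ioc (0 : ℝ) δB := ⟨hδ0, hδ.2.trans (min_le_right _ _)⟩
  set q : ℝ := ρ / R with hq
  have hq0 : 0 < q := div_pos hρ0 hR0
  have hq1 : q ≤ 1 := (div_le_one hR0).2 hρR.le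
  have hd0 : 0 ≤ d x := Metric.infDist_nonneg
  rw [rpow_three]
  -- the event and its probability
  set P := law D.carrier δ (a δ) (b δ)
      {γ | (⟨γ.walk.toCurve (meshPoint δ)⟩ : Curve ℂ).HasTraversals
        (max (kI x ρ (min (d x / 2) R)) (kB (y x) (ρ + d x) (R - d x))) x ρ R} with hP
  have hP1 : P ≤ 1 := law_apply_le_one _ _ _ _ _
  by_cases h16 : R < 16 * ρ
  · -- trivial regime: the bound is at least 1
    have hq16 : 1 / 16 < q := by
      rw [hq, lt_div_iff₀ hR0]; linarith
    have hq3 : (1 / 16 : ℝ) ^ 3 < q ^ 3 := pow_lt_pow_left₀ hq16 (by norm_num) (by norm_num)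
    have hbig : (1 : ℝ) ≤ (64 * KI + 64 * KB + 4096) * q ^ 3 := by nlinarith
    calc P ≤ 1 := hP1
      _ ≤ ENNReal.ofReal ((64 * KI + 64 * KB + 4096) * q ^ 3) := ENNReal.one_le_ofReal.2 hbig
  push Not at h16
  by_cases hcase : ρ * R ≤ d x ^ 2
  · -- interior regime: the shell `D(x; ρ, min (d/2) R)` lies inside the domain
    have hd4 : 4 * ρ ≤ d x := by
      by_contra h
      push Not at h
      nlinarith
    have hdpos : 0 < d x := by linarith
    set R' : ℝ := min (d x / 2) R with hR'
    have hρR' : ρ < R' := lt_min (by linarith) hρR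
    have hR'1 : R' ≤ 1 := (min_le_right _ _).trans hR1
    have hR'0 : 0 < R' := hρ0.trans hρR'
    have hball : Metric.closedBall x R' ⊆ D.carrier := by
      refine (Metric.closedBall_subset_ball ?_).trans Metric.ball_infDist_compl_subset
      show R' < d x
      exact (min_le_left _ _).trans_lt (by linarith)
    have hmono : P ≤ law D.carrier δ (a δ) (b δ)
        {γ | (⟨γ.walk.toCurve (meshPoint δ)⟩ : Curve ℂ).HasTraversals (kI x ρ R') x ρ R'} := by
      refine measure_mono fun γ hγ => ?_
      exact (Curve.HasTraversals.of_le hγ (le_max_left _ _)).mono' le_rfl (min_le_right _ _)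
    have hbound := HI δ hδI' x ρ R' hδρ hρR' hR'1 hball
    rw [rpow_six] at hbound
    -- `(ρ / R') ^ 6 ≤ 64 q ^ 3`
    have hkey : (ρ / R') ^ 2 ≤ 4 * q := by
      rcases le_total (d x / 2) R with h | h
      · rw [hR', min_eq_left h]
        rw [div_pow, hq, div_le_iff₀ (by positivity)]
        rw [show 4 * (ρ / R) * (d x / 2) ^ 2 = ρ * d x ^ 2 / R by ring, le_div_iff₀ hR0]
        nlinarith
      · rw [hR', min_eq_right h, ← hq]
        nlinarith
    have h64 : (ρ / R') ^ 6 ≤ 64 * q ^ 3 := by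
      calc (ρ / R') ^ 6 = ((ρ / R') ^ 2) ^ 3 := by ring
        _ ≤ (4 * q) ^ 3 := pow_le_pow_left₀ (sq_nonneg _) hkey 3
        _ = 64 * q ^ 3 := by ring
    have hreal : KI * (ρ / R') ^ 6 ≤ (64 * KI + 64 * KB + 4096) * q ^ 3 := by
      have h1 : KI * (ρ / R') ^ 6 ≤ KI * (64 * q ^ 3) := mul_le_mul_of_nonneg_left h64 hKI
      nlinarith [pow_pos hq0 3]
    exact hmono.trans (hbound.trans (ENNReal.ofReal_le_ofReal hreal))
  · -- boundary regime: re-centre at the nearest point `y x ∈ Dᶜ`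
    push Not at hcase
    have hdR : d x < R / 4 := by
      by_contra h
      push Not at h
      nlinarith
    have hyx : dist x (y x) = d x := (hdy x).symm
    set r' : ℝ := ρ + d x with hr'
    set R'' : ℝ := R - d x with hR''
    have hδr' : δ ≤ r' := by linarith
    have hr'R'' : r' < R'' := by linarith
    have hR''1 : R'' ≤ 1 := by linarith
    have hR''0 : 0 < R'' := by linarith
    have hmono : P ≤ law D.carrier δ (a δ) (b δ)
        {γ | (⟨γ.walk.toCurve (meshPoint δ)⟩ : Curve ℂ).HasTraversals
          (kB (y x) r' R'') (y x) r' R''} := by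
      refine measure_mono fun γ hγ => ?_
      refine (Curve.HasTraversals.of_le hγ (le_max_right _ _)).mono ?_ ?_
      · rw [hyx]
      · rw [hyx, hR'']; linarith
    have hbound := HB δ hδB' (y x) r' R'' (hy x) hδr' hr'R'' hR''1
    rw [rpow_six] at hbound
    have hkey : (r' / R'') ^ 2 ≤ 4 * q := by
      rw [div_pow, hq, div_le_iff₀ (by positivity)]
      rw [show 4 * (ρ / R) * R'' ^ 2 = 4 * ρ * R'' ^ 2 / R by ring, le_div_iff₀ hR0]
      have h1 : d x ^ 2 * R ≤ ρ * R * R := by nlinarith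
      have h2 : 2 * ρ * d x * R ≤ 2 * ρ * (R / 4) * R := by nlinarith
      have h3 : ρ ^ 2 * R ≤ ρ * (R / 16) * R := by nlinarith
      have h4 : 4 * ρ * (3 * R / 4) ^ 2 ≤ 4 * ρ * R'' ^ 2 := by
        have : (3 * R / 4) ^ 2 ≤ R'' ^ 2 := pow_le_pow_left₀ (by positivity) (by linarith) 2
        nlinarith
      nlinarith
    have h64 : (r' / R'') ^ 6 ≤ 64 * q ^ 3 := by
      calc (r' / R'') ^ 6 = ((r' / R'') ^ 2) ^ 3 := by ring
        _ ≤ (4 * q) ^ 3 := pow_le_pow_left₀ (sq_nonneg _) hkey 3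
        _ = 64 * q ^ 3 := by ring
    have hreal : KB * (r' / R'') ^ 6 ≤ (64 * KI + 64 * KB + 4096) * q ^ 3 := by
      have h1 : KB * (r' / R'') ^ 6 ≤ KB * (64 * q ^ 3) := mul_le_mul_of_nonneg_left h64 hKB
      nlinarith [pow_pos hq0 3]
    exact hmono.trans (hbound.trans (ENNReal.ofReal_le_ofReal hreal))

/-! ## Rev 4's stubs 3′ + 5′ give rev 5's stub and the crux, contraction-free -/

/-- **(H1) from the deep-shell tail and frontier per-shell tightness** (rev-4 stubs 3′ and 5′; neither TP₂ nor the
bubble nor any contraction is used). -/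
theorem traversalBound_of_deepTraversalTail_of_boundaryShellTight (h3 : DeepTraversalTail 20 100)
    (h5 : BoundaryShellTight) : SAWTraversalBound :=
  traversalBound_of_shellBounds (interiorShellBound_of_deepTraversalTail h3)
    (boundaryShellBound_of_boundaryShellTight h5)

/-- **Rev 4 ⇒ rev 5**: the deep-shell tail and frontier per-shell tightness imply per-shell tightness of the
traversal number for every shell (`ShellTight`), the single residual stub of rev 5. -/
theorem shellTight_of_deepTraversalTail_of_boundaryShellTight :
    DeepTraversalTail 20 100 → BoundaryShellTight → ShellTight :=
  fun h3 h5 => shellTight_of_traversalBound (traversalBound_of_deepTraversalTail_of_boundaryShellTight h3 h5)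

/-- **The crux from rev-4 stubs 3′ + 5′ alone** (the contraction pair 1′, 2′ and the landed chain are not needed). -/
theorem tpToTraversalBound_of_deepTraversalTail_of_boundaryShellTight (h3 : DeepTraversalTail 20 100)
    (h5 : BoundaryShellTight) : TPToTraversalBound :=
  fun _ _ => traversalBound_of_deepTraversalTail_of_boundaryShellTight h3 h5

/-! ## The residual is the shared precompactness item -/

/-- **`ShellTight ↔ EventualTight`**: per-shell tightness of the traversal number is EQUIVALENT to eventual tightness of the
critical SAW laws (this route's shared support item stmt-CriticalPhenomena-1881), through `shellTight_iff_traversalBound`, the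
proved glue `TraversalBoundTight_holds` (stmt-1882) and the converse `sawTraversalBound_of_eventualTight` landed for the
sibling route `SAWLeftRightFKG` (whose `SAWTraversalBound` / `EventualTight` are the same propositions). So the single
residual stub of the line reads `BoundaryTP2 → CriticalBubbleBound → EventualTight`. -/
theorem shellTight_iff_eventualTight : ShellTight ↔ EventualTight :=
  shellTight_iff_traversalBound.trans
    ⟨fun h => TraversalBoundTight_holds h,
      fun h => Summit.CriticalPhenomena.SAWScalingLimit.Theorems.sawTraversalBound_of_eventualTight h⟩

/-- **The crux in precompactness form**: `TPToTraversalBound ↔ (BoundaryTP2 → CriticalBubbleBound → EventualTight)`. -/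
theorem tpToTraversalBound_iff_eventualTight :
    TPToTraversalBound ↔ (BoundaryTP2 → CriticalBubbleBound → EventualTight) :=
  tpToTraversalBound_iff_shellTight.trans
    ⟨fun h hTP hB => shellTight_iff_eventualTight.1 (h hTP hB),
      fun h hTP hB => shellTight_iff_eventualTight.2 (h hTP hB)⟩

end Summit.CriticalPhenomena.SAWScalingLimit.Theorems.TPToTraversalBound.Radial

end
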